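import Summits.Langlands.Langlands.Theorems.SelfTwistRankSplitHeart
import Summits.Langlands.Langlands.Theses.CyclicLayerPeeling
import Summits.Langlands.Langlands.Theses.GaloisHullLift
import Summits.Langlands.Langlands.Theorems.RootDecomp1InductionTransport
import Literature.NumberTheory.Automorphic.ReciprocityGLnRankOneProofs
import Literature.NumberTheory.Automorphic.AlgebraicityParityGL
import Literature.NumberTheory.Automorphic.AutomorphicInductionOfSelfTwist
import Literature.NumberTheory.Automorphic.HenniartAutomorphicInductionProofs
import Literature.NumberTheory.Automorphic.HilbertModularGaloisRepProofs
import HarnessLib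

/-!
# Self-twist rank split (decomp-langlands lens-4 "minimal-counterexample / extremal reduction", gen 38)

NODE on TWO registered rank-4 leaves at once — SELF = `CyclicLayerPeeling.SelfTwistedLayerDescent`
(stmt-Langlands-27862, crux r4, route-Langlands-CyclicLayerPeeling) and RSELF =
`GaloisHullLift.SelfTwistedHullDescent` (stmt-Langlands-28226, crux r4, route-Langlands-GaloisHullLift):
descent of (relative) avatars through a layer along which the cuspidal `π` on `GL_n/K` is
SELF-TWISTED, i.e. its Satake multisets are `ζ_p`-stable at the places inert in a cyclic sub-layer
`F/K` of prime degree `p`.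

## Lens-4 normal form: order counterexamples by (rank `n`, twisting degree `p`)

* **`p ∤ n` — VOID, PROVED WALL** (`finrank_dvd_of_selfTwistGuard`, module
  `SelfTwistRankSplitHeart`): a `ζ_p`-stable multiset of `n` NON-ZERO Satake parameters has
  `ζ_p ^ n = 1` (compare products; `hasSatakeParamAt_ne_zero_holds`, `HasSatakeParamAt.card_eq`),
  and inert places exist in every cofinite set by the tree's PROVED cyclic Chebotarev theorem
  (`infinite_setOf_frobenius_eq_of_isCyclic chebotarev_cyclotomicExtension_holds`; a Frobenius
  `g ≠ 1` at `Q` forces `f(Q|q) ≠ 1`, `inertiaDeg_ne_one_of_frobenius_eq`).  So `p ∣ n` — the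
  divisibility that the tree's rendering of Arthur–Clozel Thm. 4.2 (b)
  (`ArthurClozel1989_automorphicInduction_of_selfTwist`, hypothesis `n = m·l`) ASSUMES is a theorem
  of the Satake-level self-twist.
* **`p = n` — PRSA = `PrimeRankSelfTwistAvatar`** [new · ATTACKABLE │ CLOSED MODULO PRINT,
  kernel `primeRankSelfTwistAvatar_of_print`]: `π = AI_{F/K}(χ)` with `χ` on `GL_1/F`
  (Arthur–Clozel 4.2 (b), `m = 1`, named fact BY NAME), `χ` is `L`-algebraic (Henniart's archimedean
  relation, named fact BY NAME, + existence of an infinity type for `GL_1` data, the tree's per-datum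
  named fact), `χ` has an `ℓ`-adic avatar (Weil — `exists_satakeFrobCompatible_rankOne`, the tree's rank-one theorem of `ReciprocityUpToIrreducibility` re-proved here from its Literature leaves),
  and avatars induce (tree THEOREM `inductionTransport_proof` = AIT stmt-Langlands-29151).  PHANTOM-FREE:
  the base change `P` / the relative avatar `r` of the items is not used in this sector.
* **`p ∣ n`, `p < n` — the DECLARED RESIDUALS** SELF_comp = `CompositeRankSelfTwistedLayerDescent`,
  RSELF_comp = `CompositeRankSelfTwistedHullDescent` [new · RESIDUAL │ IDEA-NEEDED]: the items
  verbatim with `[F:K] ∣ n ∧ [F:K] < n` inserted — a minimal counterexample to SELF or RSELF has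
  COMPOSITE rank `n ≥ 4` and twisting degree a proper prime divisor of `n`.  For `n` prime
  (`2, 3, 5, 7, …`) both items are PRSA alone (`compositeRankSelfTwistedLayerDescent_prime_rank_vacuous`).

## Ledger (kernels, all 0 sorry)

* `closes_self  : PrimeRankSelfTwistAvatar → CompositeRankSelfTwistedLayerDescent → SelfTwistedLayerDescent`
* `closes_rself : PrimeRankSelfTwistAvatar → CompositeRankSelfTwistedHullDescent → SelfTwistedHullDescent`
* necessity (EXACT residuals): `compositeRankSelfTwistedLayerDescent_of_self`,
  `compositeRankSelfTwistedHullDescent_of_rself`; no excess: `primeRankSelfTwistAvatar_of_semisimpleAvatar`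
  (PRSA ⟸ `RootDecomp1.SemisimpleAvatar` ⟸ `Langlands`).
* print closure: `primeRankSelfTwistAvatar_of_print (hAC) (hH) (hInf) : PrimeRankSelfTwistAvatar`,
  `closes_self_of_print`, `closes_rself_of_print` — binders = exactly the three named facts
  `ArthurClozel1989_automorphicInduction_of_selfTwist`, `Henniart2012_infinityType_of_automorphicInduction`,
  `∀ GL_1-data, AutomorphicRepData.exists_hasInfinityType`.
* walls/lemmas: `finrank_dvd_of_selfTwistGuard`, `infinite_setOf_inert`, `dvd_card_of_map_mul_eq`
  (Heart); `acGuard_of_selfTwistGuard` (items' guard ⟹ Arthur–Clozel's hypothesis: equal residue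
  degrees in a Galois layer + all primitive roots are powers of one),
  `isLAlgebraic_of_isAutomorphicInductionAlong` (L-algebraicity descends along cyclic automorphic
  induction, any rank — Henniart).

Differs by construction from the other lenses' current nodes (lens-1 degree/solvable-length ladders,
lens-2 motivic sectors, lens-3 exact-sequence translation, lens-5 Mordell–Weil ranks, lens-6
certificate leaves): none touches SELF/RSELF.  Nearest prior art in the cell: lens-3 g17
`CyclicDeinduction*` de-induces AVATARS (Galois side, needs `ConjugateUnmixing`); this node
de-induces the AUTOMORPHIC side at prime rank and needs no unmixing.  TYPED, NOT FILED (route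
freeze): census twin = the pair `SelfTwistRankSplitHeart` + this module, `--supports
stmt-Langlands-27862 --as helper` (and by name also closes the `p = n` sector of stmt-Langlands-28226).

References: Arthur–Clozel, *Simple algebras, base change, and the advanced theory of the trace
formula*, Ann. of Math. Stud. 120 (1989), Ch. 3, Thm. 4.2 (b), Lemma 6.4, (6.6), Thm. 6.2;
G. Henniart, *Induction automorphe globale pour les corps de nombres*, Bull. SMF 140 (2012), Thm. 5;
L. Clozel, *Motifs et formes automorphes* (1990), §3.3; A. Weil, *On a certain type of characters of
the idèle-class group* (1956); J.-P. Serre, *Abelian ℓ-adic representations* (1968), Ch. I §2.3;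
D. Marcus, *Number Fields*, Ch. 4, Thm. 32.
-/

set_option linter.dupNamespace false

open NumberField IsDedekindDomain Filter
open scoped Classical

namespace Summit.Langlands.Langlands.Theorems.SelfTwistRankSplit

open Literature.NumberTheory.GaloisRepresentations Literature.NumberTheory.Automorphic
open Summit.Langlands.Langlands.Theses

/-! ## §5 The pieces (typed, NOT filed: route freeze) -/

/-- **PRSA — `PrimeRankSelfTwistAvatar`** [new · ATTACKABLE │ closed modulo PRINT by
`primeRankSelfTwistAvatar_of_print`]. A cuspidal `L`-algebraic `π` on `GL_n/K` that is
self-twisted (a.e. Satake multisets `ζ_n`-stable at the inert places) along a cyclic Galois layer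
`F/K` of prime degree EQUAL TO THE RANK `n` has, for every `ℓ` and `ι`, a semisimple `ℓ`-adic
avatar matching its Satake parameters almost everywhere.  Mechanism: Arthur–Clozel Ch. 3
Thm. 4.2 (b)/Lemma 6.4 de-induce `π = AI_{F/K}(χ)` with `χ` a cuspidal datum on `GL_1/F`
(tree named fact `ArthurClozel1989_automorphicInduction_of_selfTwist`, `m = 1`); `χ` is
`L`-algebraic by Henniart's archimedean relation (`Henniart2012_infinityType_of_automorphicInduction`)
once it has an infinity type (`AutomorphicRepData.exists_hasInfinityType`, Clozel 1990 §3.3 at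
`n = 1`); Weil's `ℓ`-adic character of an algebraic Hecke character is the tree's THEOREM
`ReciprocityUpToIrreducibility.exists_satakeFrobCompatible_rankOne`; and avatars induce along
a.e. automorphic induction by the tree's THEOREM `inductionTransport_proof`
(= `RootDecomp1.InductionTransport`, stmt-Langlands-29151).  No phantom (`M`, `P`, `r`) is used:
the piece is phantom-free and implied by `RootDecomp1.SemisimpleAvatar`
(`primeRankSelfTwistAvatar_of_semisimpleAvatar`), hence by `Langlands`.  It is the sector
`p = n` of BOTH `CyclicLayerPeeling.SelfTwistedLayerDescent` (stmt-Langlands-27862) and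
`GaloisHullLift.SelfTwistedHullDescent` (stmt-Langlands-28226).
[ref: ArthurClozelAMS120, Ch. 3 Thm. 4.2 (b), Lemma 6.4, Thm. 6.2] [ref: Henniart2012, Thm. 5]
[ref: Clozel1990, §3.3] [ref: SerreAbelianLadic1968, Ch. I §2.3] -/
def PrimeRankSelfTwistAvatar : Prop :=
  ∀ (K : Type) [Field K] [NumberField K] (n : ℕ) (hcpt : Literature.NumberTheory.Automorphic.isCompact_glFiniteIntegralLevel n K), 0 < n → ∀ (π : Literature.NumberTheory.Automorphic.CuspidalAutomorphicRepData n K hcpt), π.1.IsLAlgebraic → ∀ (F : Type) [Field F] [NumberField F] [Algebra K F], IsGalois K F → IsCyclic (F ≃ₐ[K] F) → Module.finrank K F = n → (Module.finrank K F).Prime → (∀ᶠ v : IsDedekindDomain.HeightOneSpectrum (NumberField.RingOfIntegers K) in cofinite, (∀ w : IsDedekindDomain.HeightOneSpectrum (NumberField.RingOfIntegers F), w.asIdeal.under (NumberField.RingOfIntegers K) = v.asIdeal → w.asIdeal.inertiaDeg (NumberField.RingOfIntegers K) ≠ 1) → ∀ α : Multiset ℂ, π.1.HasSatakeParamAt v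 α → α.map (fun z => Complex.exp (2 * Real.pi * Complex.I / (Module.finrank K F : ℂ)) * z) = α) → ∀ (ℓ : ℕ) [Fact ℓ.Prime] (ι : PadicAlgCl ℓ ≃+* ℂ), ∃ ρ : Literature.NumberTheory.GaloisRepresentations.FramedGaloisRep K (PadicAlgCl ℓ) n, ρ.toGaloisRep.IsSemisimple ∧ ∀ᶠ v : IsDedekindDomain.HeightOneSpectrum (NumberField.RingOfIntegers K) in cofinite, SatakeFrobCompatibleAt ι π.1 ρ v

/-- **SELF_comp — `CompositeRankSelfTwistedLayerDescent`** [new · DECLARED RESIDUAL │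
IDEA-NEEDED]. Verbatim `CyclicLayerPeeling.SelfTwistedLayerDescent` (stmt-Langlands-27862) with
the two conjuncts `[F:K] ∣ n ∧ [F:K] < n` inserted in the witness clause: the self-twisting cyclic
layer `F ⊊ M` has prime degree a PROPER divisor of the rank (so `n ≥ 4` is composite).  EXACT
restriction: implied by the item (`compositeRankSelfTwistedLayerDescent_of_self`), and with PRSA
it gives the item back (`closes_self`; the sector `[F:K] ∤ n` is void by the PROVED wall
`finrank_dvd_of_selfTwistGuard`).  Attack foreseen (not typed — lineage depth rule): de-induce
`π = AI_{F/K}(Π₁)`, `Π₁` cuspidal `L`-algebraic on `GL_{n/p}/F` (same named facts as PRSA with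
`m = n/p`), then EITHER direction (A) for `Π₁` in rank `n/p < n` over `F` composed with
`inductionTransport_proof`, OR a non-solvable base-change phantom lemma producing a phantom of
`Π₁` along `M/F`; the first is `RootDecomp1.SemisimpleAvatar` one rank-level down, the second is
open (Getz–Hahn §13.5).  True if `Langlands`. -/
def CompositeRankSelfTwistedLayerDescent : Prop :=
  ∀ (K : Type) [Field K] [NumberField K] (n : ℕ) (hcpt : Literature.NumberTheory.Automorphic.isCompact_glFiniteIntegralLevel n K), 0 < n → ∀ (π : Literature.NumberTheory.Automorphic.CuspidalAutomorphicRepData n K hcpt), π.1.IsLAlgebraic → ∀ (M : Type) [Field M] [NumberField M] [Algebra K M], (∃ F : IntermediateField K M, F ≠ ⊥ ∧ F ≠ ⊤ ∧ IsGalois K ↥F ∧ IsCyclic (↥F ≃ₐ[K] ↥F) ∧ (Module.finrank K ↥F).Prime ∧ Module.finrank K ↥F ∣ n ∧ Module.finrank K ↥F < n ∧ (∀ᶠ v : IsDedekindDomain.HeightOneSpectrum (NumberField.RingOfIntegers K) in cofinite, (∀ w : IsDedekindDomain.HeightOneSpectrum (NumberField.RingOfIntegers ↥F), w.asIdeal.under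 (NumberField.RingOfIntegers K) = v.asIdeal → w.asIdeal.inertiaDeg (NumberField.RingOfIntegers K) ≠ 1) → ∀ α : Multiset ℂ, π.1.HasSatakeParamAt v α → α.map (fun z => Complex.exp (2 * Real.pi * Complex.I / (Module.finrank K ↥F : ℂ)) * z) = α)) → ∀ (hM : Literature.NumberTheory.Automorphic.isCompact_glFiniteIntegralLevel n M) (P : Literature.NumberTheory.Automorphic.CuspidalAutomorphicRepData n M hM), P.1.IsLAlgebraic → Literature.NumberTheory.Automorphic.IsWeakBaseChangeLiftAE π.1 P.1 → ∀ (ℓ : ℕ) [Fact ℓ.Prime] (ι : PadicAlgCl ℓ ≃+* ℂ) (r : Literature.NumberTheory.GaloisRepresentations.FramedGaloisRep M (PadicAlgCl ℓ) n), r.toGaloisRep.IsSemisimple → (∀ᶠ w : IsDedekindDomain.HeightOneSpectrum (NumberField.RingOfIntegers M) in cofinite, SatakeFrobCompatibleAt ι P.1 r w) → ∃ ρ : Literature.NumberTheory.GaloisRepresentations.FramedGaloisRep K (PadicAlgCl ℓ) n, ρ.toGaloisRep.IsSemisimple ∧ ∀ᶠ v : IsDedekindDomain.HeightOneSpectrum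 (NumberField.RingOfIntegers K) in cofinite, SatakeFrobCompatibleAt ι π.1 ρ v

/-- **RSELF_comp — `CompositeRankSelfTwistedHullDescent`** [new · DECLARED RESIDUAL │
IDEA-NEEDED]. Verbatim `GaloisHullLift.SelfTwistedHullDescent` (stmt-Langlands-28226) with
`[F:K] ∣ n ∧ [F:K] < n` inserted in the existential witness clause (some bottom cyclic layer of
prime degree a PROPER divisor of the rank; all bottom cyclic prime layers self-twisting, as in the
item).  EXACT restriction (`compositeRankSelfTwistedHullDescent_of_rself`, `closes_rself`).  The
item's rank induction hypothesis is kept verbatim: the foreseen attack de-induces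
`π = AI_{F/K}(Π₁)` to rank `n/p < n` over `F` and wants the IH for `(F, Π₁, L/F)`, which needs a
RELATIVE avatar of `Π₁` along `L/F` carved out of the given relative avatar `r` of `π` — the
conjugate-unmixing problem of `CyclicDeinductionCarving.ConjugateUnmixing` (lens-3 lineage), open.
True if `Langlands`. -/
def CompositeRankSelfTwistedHullDescent : Prop :=
  ∀ (K : Type) [Field K] [NumberField K] (n : ℕ) (hcpt : Literature.NumberTheory.Automorphic.isCompact_glFiniteIntegralLevel n K), 0 < n → (∀ (m : ℕ), m < n → ∀ (K' : Type) [Field K'] [NumberField K'] (hcpt' : Literature.NumberTheory.Automorphic.isCompact_glFiniteIntegralLevel m K'), 0 < m → ∀ (π' : Literature.NumberTheory.Automorphic.CuspidalAutomorphicRepData m K' hcpt'), π'.1.IsLAlgebraic → ∀ (L' : Type) [Field L'] [NumberField L'] [Algebra K' L'], IsGalois K' L' → ∀ (ℓ : ℕ) [Fact ℓ.Prime] (ι : PadicAlgCl ℓ ≃+* ℂ) (r : Literature.NumberTheory.GaloisRepresentations.FramedGaloisRep L' (PadicAlgCl ℓ) m), r.toGaloisRep.IsSemisimple → (∀ᶠ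 w : IsDedekindDomain.HeightOneSpectrum (NumberField.RingOfIntegers L') in cofinite, ∀ (v : IsDedekindDomain.HeightOneSpectrum (NumberField.RingOfIntegers K')) (α : Multiset ℂ), w.asIdeal.under (NumberField.RingOfIntegers K') = v.asIdeal → π'.1.HasSatakeParamAt v α → r.IsUnramifiedAt w ∧ r.HasFrobCharpolyAt w (Literature.NumberTheory.Automorphic.arithFrobPolyOfSatake ι w.residueCard 1 (α.map (fun a => a ^ w.asIdeal.inertiaDeg (NumberField.RingOfIntegers K'))))) → ∃ ρ : Literature.NumberTheory.GaloisRepresentations.FramedGaloisRep K' (PadicAlgCl ℓ) m, ρ.toGaloisRep.IsSemisimple ∧ ∀ᶠ v : IsDedekindDomain.HeightOneSpectrum (NumberField.RingOfIntegers K') in cofinite, SatakeFrobCompatibleAt ι π'.1 ρ v) → ∀ (π : Literature.NumberTheory.Automorphic.CuspidalAutomorphicRepData n K hcpt), π.1.IsLAlgebraic → ∀ (L : Type) [Field L] [NumberField L] [Algebra K L], IsGalois K L → (∃ F : IntermediateField K L, F ≠ ⊥ ∧ IsGalois K ↥F ∧ IsCyclic (↥F ≃ₐ[K] ↥F) ∧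 (Module.finrank K ↥F).Prime ∧ Module.finrank K ↥F ∣ n ∧ Module.finrank K ↥F < n) → (∀ F : IntermediateField K L, F ≠ ⊥ → IsGalois K ↥F → IsCyclic (↥F ≃ₐ[K] ↥F) → (Module.finrank K ↥F).Prime → (∀ᶠ v : IsDedekindDomain.HeightOneSpectrum (NumberField.RingOfIntegers K) in cofinite, (∀ w : IsDedekindDomain.HeightOneSpectrum (NumberField.RingOfIntegers ↥F), w.asIdeal.under (NumberField.RingOfIntegers K) = v.asIdeal → w.asIdeal.inertiaDeg (NumberField.RingOfIntegers K) ≠ 1) → ∀ α : Multiset ℂ, π.1.HasSatakeParamAt v α → α.map (fun z => Complex.exp (2 * Real.pi * Complex.I / (Module.finrank K ↥F : ℂ)) * z) = α)) → ∀ (ℓ : ℕ) [Fact ℓ.Prime] (ι : PadicAlgCl ℓ ≃+* ℂ) (r : Literature.NumberTheory.GaloisRepresentations.FramedGaloisRep L (PadicAlgCl ℓ) n), r.toGaloisRep.IsSemisimple → (∀ᶠ w : IsDedekindDomain.HeightOneSpectrum (NumberField.RingOfIntegers L) in cofinite, ∀ (v : IsDedekindDomain.HeightOneSpectrum (NumberField.RingOfIntegers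 K)) (α : Multiset ℂ), w.asIdeal.under (NumberField.RingOfIntegers K) = v.asIdeal → π.1.HasSatakeParamAt v α → r.IsUnramifiedAt w ∧ r.HasFrobCharpolyAt w (Literature.NumberTheory.Automorphic.arithFrobPolyOfSatake ι w.residueCard 1 (α.map (fun a => a ^ w.asIdeal.inertiaDeg (NumberField.RingOfIntegers K))))) → ∃ ρ : Literature.NumberTheory.GaloisRepresentations.FramedGaloisRep K (PadicAlgCl ℓ) n, ρ.toGaloisRep.IsSemisimple ∧ ∀ᶠ v : IsDedekindDomain.HeightOneSpectrum (NumberField.RingOfIntegers K) in cofinite, SatakeFrobCompatibleAt ι π.1 ρ v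

/-! ## §6 Kernels: the two items from PRSA and their composite-rank residuals (0 sorry) -/

/-- **SELF ⟸ PRSA ∧ SELF_comp.**  Given the item's data, the self-twisting layer `F` has prime
degree `p ∣ n` by the PROVED wall `finrank_dvd_of_selfTwistGuard`; if `p < n` the residual
applies verbatim, else `p = n` and PRSA gives the avatar (the phantom is discarded). [folklore] -/
theorem closes_self (hP : PrimeRankSelfTwistAvatar) (hC : CompositeRankSelfTwistedLayerDescent) :
    CyclicLayerPeeling.SelfTwistedLayerDescent := by
  intro K _ _ n hcpt hn π hπ M _ _ _ hex hM P hPL hBC ℓ _ ι r hr hrc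
  obtain ⟨F, hbot, htop, hGal, hcycF, hpF, hguard⟩ := hex
  haveI : IsGalois K ↥F := hGal
  have hdvd : Module.finrank K ↥F ∣ n :=
    finrank_dvd_of_selfTwistGuard π (↥F) hcycF hpF.one_lt hguard
  by_cases hlt : Module.finrank K ↥F < n
  · exact hC K n hcpt hn π hπ M ⟨F, hbot, htop, hGal, hcycF, hpF, hdvd, hlt, hguard⟩ hM P hPL hBC ℓ
      ι r hr hrc
  · have heq : Module.finrank K ↥F = n := by
      have := Nat.le_of_dvd hn hdvd
      omega
    exact hP K n hcpt hn π hπ (↥F) hGal hcycF heq hpF hguard ℓ ι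

/-- **RSELF ⟸ PRSA ∧ RSELF_comp** (same dichotomy on the degree of the given bottom cyclic layer;
the item's rank-induction hypothesis is passed through untouched). [folklore] -/
theorem closes_rself (hP : PrimeRankSelfTwistAvatar) (hC : CompositeRankSelfTwistedHullDescent) :
    GaloisHullLift.SelfTwistedHullDescent := by
  intro K _ _ n hcpt hn IH π hπ L _ _ _ hGalL hex hall ℓ _ ι r hr hrel
  obtain ⟨F, hbot, hGal, hcycF, hpF⟩ := hex
  haveI : IsGalois K ↥F := hGal
  have hguard := hall F hbot hGal hcycF hpF
  have hdvd : Module.finrank K ↥F ∣ n :=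
    finrank_dvd_of_selfTwistGuard π (↥F) hcycF hpF.one_lt hguard
  by_cases hlt : Module.finrank K ↥F < n
  · exact hC K n hcpt hn IH π hπ L hGalL ⟨F, hbot, hGal, hcycF, hpF, hdvd, hlt⟩ hall ℓ ι r hr hrel
  · have heq : Module.finrank K ↥F = n := by
      have := Nat.le_of_dvd hn hdvd
      omega
    exact hP K n hcpt hn π hπ (↥F) hGal hcycF heq hpF hguard ℓ ι

/-- Necessity: the composite-rank residual is a verbatim restriction of the item. [folklore] -/
theorem compositeRankSelfTwistedLayerDescent_of_self (h : CyclicLayerPeeling.SelfTwistedLayerDescent) :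
    CompositeRankSelfTwistedLayerDescent := by
  intro K _ _ n hcpt hn π hπ M _ _ _ hex
  obtain ⟨F, hbot, htop, hGal, hcycF, hpF, -, -, hguard⟩ := hex
  exact h K n hcpt hn π hπ M ⟨F, hbot, htop, hGal, hcycF, hpF, hguard⟩

/-- Necessity: the composite-rank residual is a verbatim restriction of the item. [folklore] -/
theorem compositeRankSelfTwistedHullDescent_of_rself (h : GaloisHullLift.SelfTwistedHullDescent) :
    CompositeRankSelfTwistedHullDescent := by
  intro K _ _ n hcpt hn IH π hπ L _ _ _ hGalL hex
  obtain ⟨F, hbot, hGal, hcycF, hpF, -, -⟩ := hex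
  exact h K n hcpt hn IH π hπ L hGalL ⟨F, hbot, hGal, hcycF, hpF⟩

/-- No excess: PRSA is a restriction of the host piece `RootDecomp1.SemisimpleAvatar`
(stmt-Langlands-23598, implied by `Langlands`), so the node adds no strength beyond the root.
[folklore] -/
theorem primeRankSelfTwistAvatar_of_semisimpleAvatar (hE : RootDecomp1.SemisimpleAvatar) :
    PrimeRankSelfTwistAvatar := by
  intro K _ _ n hcpt hn π hπ F _ _ _ _ _ _ _ _ ℓ _ ι
  exact hE K n hcpt hn π hπ ℓ ι

/-! ## §7 PRSA closed modulo PRINT: de-induction to `GL_1`, Henniart, Weil, induction transport -/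

/-- **`L`-algebraicity descends along automorphic induction** (cyclic layer `E/K`, any rank):
if `P` on `GL_{[E:K] m}/K` is `L`-algebraic and a.e. automorphically induced from `P₁` on
`GL_m/E`, and `P₁` has an infinity type at all, then `P₁` is `L`-algebraic — by Henniart's
archimedean relation the `z`-exponents of `P₁` at `σ'` are among those of `P` at `σ'|K`
(integers), and the `z̄`-exponents at `σ'` are the `z`-exponents at `σ̄'` (well-formedness).
Same argument as the tree's `isRegularAlgebraic_of_isAutomorphicInductionAlong_two_two`.
[cite: Henniart2012, Thm. 5 and §3.7] [cite: BuzzardGee2014, Def. 3.1.1] -/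
theorem isLAlgebraic_of_isAutomorphicInductionAlong
    (hH : Henniart2012_infinityType_of_automorphicInduction)
    {K E : Type} [Field K] [NumberField K] [Field E] [NumberField E] [Algebra K E] [IsGalois K E]
    (hcyc : IsCyclic (E ≃ₐ[K] E)) {m N : ℕ} (hm : 0 < m) (hN : Module.finrank K E * m = N)
    {hK : isCompact_glFiniteIntegralLevel N K} {hE : isCompact_glFiniteIntegralLevel m E}
    (P : CuspidalAutomorphicRepData N K hK) (P₁ : CuspidalAutomorphicRepData m E hE)
    (hAI : IsAutomorphicInductionAlong P₁.1 P.1) (hP : P.1.IsLAlgebraic)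
    (hex : P₁.1.exists_hasInfinityType) : P₁.1.IsLAlgebraic := by
  subst hN
  obtain ⟨TP, hTP, hTPalg⟩ := hP
  obtain ⟨T, hT⟩ := hex
  have hrel := (Henniart2012_infinityType_of_automorphicInduction_iff_along.mp hH) K E hcyc m
    (Module.finrank K E) hm rfl hK hE P P₁ hAI TP T hTP hT
  have hsub : ∀ σ' : E →+* ℂ,
      (T σ').map ArchWeight.a ≤ (TP (σ'.comp (algebraMap K E))).map ArchWeight.a := by
    intro σ'
    rw [hrel]
    exact Finset.single_le_sum (f := fun σ'' : E →+* ℂ => (T σ'').map ArchWeight.a)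
      (fun _ _ => Multiset.zero_le _) (by simp)
  have ha : ∀ (σ' : E →+* ℂ) (q : ArchWeight), q ∈ T σ' → ∃ k : ℤ, q.a = k := by
    intro σ' q hq
    have hmem : q.a ∈ (TP (σ'.comp (algebraMap K E))).map ArchWeight.a :=
      Multiset.mem_of_le (hsub σ') (Multiset.mem_map_of_mem _ hq)
    obtain ⟨q', hq', hqa⟩ := Multiset.mem_map.mp hmem
    obtain ⟨k, l, hk, -⟩ := hTPalg _ q' hq'
    exact ⟨k, by rw [← hqa, hk]⟩
  refine ⟨T, hT, fun σ' q hq => ?_⟩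
  obtain ⟨k, hk⟩ := ha σ' q hq
  have hswap : q.swap ∈ T (NumberField.ComplexEmbedding.conjugate σ') := by
    rw [hT.1.2 σ']
    exact Multiset.mem_map_of_mem _ hq
  obtain ⟨l, hl⟩ := ha _ q.swap hswap
  exact ⟨k, l, hk, hl⟩

/-- **The items' self-twist guard implies Arthur–Clozel's hypothesis** of
`ArthurClozel1989_automorphicInduction_of_selfTwist`: at a.e. `v`, for `w ∣ v` of residue degree
`[F:K]` (so every `w' ∣ v` has residue degree `≠ 1`, all residue degrees over `v` being equal in
the Galois layer, Mathlib `Ideal.inertiaDeg_eq_of_isGaloisGroup`) the Satake multiset is stable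
under `exp(2πi/[F:K])`, hence under every primitive `[F:K]`-th root of unity (a power of it,
`map_mul_eq_of_isPrimitiveRoot`). [folklore] -/
theorem acGuard_of_selfTwistGuard {K F : Type} [Field K] [NumberField K] [Field F] [NumberField F]
    [Algebra K F] [IsGalois K F] (hp : (Module.finrank K F).Prime) {n : ℕ}
    {hcpt : isCompact_glFiniteIntegralLevel n K} (π : CuspidalAutomorphicRepData n K hcpt)
    (hguard : (∀ᶠ v : IsDedekindDomain.HeightOneSpectrum (NumberField.RingOfIntegers K) in cofinite, (∀ w : IsDedekindDomain.HeightOneSpectrum (NumberField.RingOfIntegers F), w.asIdeal.under (NumberField.RingOfIntegers K) = v.asIdeal → w.asIdeal.inertiaDeg (NumberField.RingOfIntegers K) ≠ 1) → ∀ α : Multiset ℂ, π.1.HasSatakeParamAt v α → α.map (fun z => Complex.exp (2 * Real.pi * Complex.I / (Module.finrank K F : ℂ)) * z) = α)) :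
    ∀ᶠ v : HeightOneSpectrum (𝓞 K) in cofinite, ∀ (w : HeightOneSpectrum (𝓞 F)) (α : Multiset ℂ),
      w.asIdeal.under (𝓞 K) = v.asIdeal → w.asIdeal.inertiaDeg (𝓞 K) = Module.finrank K F →
        π.1.HasSatakeParamAt v α → ∀ ζ : ℂ, IsPrimitiveRoot ζ (Module.finrank K F) →
          α.map (ζ * ·) = α := by
  filter_upwards [hguard] with v hv w α hw hf hα ζ hζ
  have hinert : ∀ w' : HeightOneSpectrum (𝓞 F), w'.asIdeal.under (𝓞 K) = v.asIdeal →
      w'.asIdeal.inertiaDeg (𝓞 K) ≠ 1 := by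
    intro w' hw'
    haveI : IsGaloisGroup (F ≃ₐ[K] F) (𝓞 K) (𝓞 F) := IsGaloisGroup.of_isFractionRing _ _ _ K F
    haveI := w.isPrime
    haveI := w'.isPrime
    haveI : w.asIdeal.LiesOver v.asIdeal := ⟨hw.symm⟩
    haveI : w'.asIdeal.LiesOver v.asIdeal := ⟨hw'.symm⟩
    haveI : v.asIdeal.IsMaximal := v.isMaximal
    rw [Ideal.inertiaDeg_eq_of_isGaloisGroup v.asIdeal w'.asIdeal w.asIdeal (F ≃ₐ[K] F), hf]
    exact hp.one_lt.ne'
  have h := hv hinert α hα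
  haveI : NeZero (Module.finrank K F) := ⟨hp.ne_zero⟩
  exact map_mul_eq_of_isPrimitiveRoot (Complex.isPrimitiveRoot_exp _ hp.ne_zero) hζ h

/-- **Weil's `ℓ`-adic avatar of an `L`-algebraic cuspidal datum on `GL_1`** (direction (A') at
`n = 1`, Satake half): verbatim the tree's theorem
`ReciprocityUpToIrreducibility.exists_satakeFrobCompatible_rankOne` (module
`Theorems.IrreducibilityBySelfDualityReciprocityUpToIrreducibilityRankOne`, re-proved here from its
Literature leaves so that this module does not import that Theorems module): the Hecke character
`χ_π` is algebraic (`L`-algebraic = `C`-algebraic for `n = 1`), Weil's `ℓ`-adic character of `χ_π`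
(`HeckeCharacter.IsAlgebraic.exists_lAdic`) is unramified with `char(Frob_v) = X - ι⁻¹(χ_π(ϖ_v))⁻¹`
at the `v ∤ ℓ` where `χ_π` is unramified, and `π` is unramified a.e. (Flath) with Satake parameter
`{χ_π(ϖ_v)}` there. [cite: Weil1956, §1–§2] [cite: BuzzardGeeLMS2014, Conj. 3.2.1 (case n = 1)] -/
theorem exists_satakeFrobCompatible_rankOne {K : Type} [Field K] [NumberField K] {ℓ : ℕ}
    [Fact ℓ.Prime] (hcpt : isCompact_glFiniteIntegralLevel 1 K)
    (π : CuspidalAutomorphicRepData 1 K hcpt) (hL : π.1.IsLAlgebraic) (ι : PadicAlgCl ℓ ≃+* ℂ) :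
    ∃ ρ : FramedGaloisRep K (PadicAlgCl ℓ) 1,
      ∀ᶠ v : HeightOneSpectrum (𝓞 K) in cofinite, SatakeFrobCompatibleAt ι π.1 ρ v := by
  classical
  obtain ⟨χ, hχ⟩ := π.1.exists_heckeCharacter_glOne
  have halg : χ.IsAlgebraic :=
    π.1.isAlgebraic_heckeCharacter_glOne_of_isCAlgebraic hχ (hL.isCAlgebraic_of_odd odd_one)
  obtain ⟨r, hr⟩ := halg.exists_lAdic ι
  have hunr : ∀ᶠ v : HeightOneSpectrum (𝓞 K) in cofinite, π.1.IsUnramifiedAt v :=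
    π.1.hasSatakeParamAt_cofinite_holds
  refine ⟨r, ?_⟩
  filter_upwards [Literature.NumberTheory.Automorphic.eventually_natCast_notMem_asIdeal K ℓ, hunr] with v hvℓ hv
  obtain ⟨α, hα⟩ := hv
  have hur : χ.IsUnramifiedAt v := π.1.isUnramifiedAt_heckeCharacter_glOne hχ hα
  obtain ⟨hunr, hfrob⟩ := hr v hvℓ hur
  refine ⟨α, hα, hunr, ?_⟩
  obtain ⟨ϖ, hϖ, rfl⟩ := π.1.exists_eq_singleton_of_hasSatakeParamAt_glOne hχ hα
  have hc : ((χ (localUnits v ϖ) : ℂˣ) : ℂ) = χ.valueAtUniformizer v := by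
    rw [← HeckeCharacter.localComponent_eq_valueAtUniformizer hur hϖ,
      HeckeCharacter.localComponent_apply]
  rw [arithFrobPolyOfSatake_one, Multiset.map_singleton, Multiset.prod_singleton, hc]
  exact hfrob

/-- **PRSA closed modulo PRINT.**  Inputs BY NAME: the tree's named facts
`ArthurClozel1989_automorphicInduction_of_selfTwist` (Arthur–Clozel Ch. 3 Thm. 4.2 (b) + Lemma
6.4 in the datum model, used with `m = 1`), `Henniart2012_infinityType_of_automorphicInduction`
(archimedean components of automorphic induction) and the existence of infinity types for cuspidal
data on `GL_1` (`AutomorphicRepData.exists_hasInfinityType`, Clozel 1990 §3.3 for `n = 1`);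
everything else is a THEOREM of the tree: `acGuard_of_selfTwistGuard`,
`isLAlgebraic_of_isAutomorphicInductionAlong`, Weil's `ℓ`-adic avatar of an algebraic Hecke
character `exists_satakeFrobCompatible_rankOne` (the tree's rank-one (A'), re-proved here), rank-one
semisimplicity `FramedRep.isSemisimple_of_rank_one`, and induction transport
`inductionTransport_proof` (`RootDecomp1.InductionTransport`, stmt-Langlands-29151).
[cite: ArthurClozelAMS120, Ch. 3 Thm. 4.2 (b), Lemma 6.4, Thm. 6.2] [cite: Henniart2012, Thm. 5]
[cite: Clozel1990, §3.3] -/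
theorem primeRankSelfTwistAvatar_of_print
    (hAC : ArthurClozel1989_automorphicInduction_of_selfTwist)
    (hH : Henniart2012_infinityType_of_automorphicInduction)
    (hInf : ∀ (E : Type) [Field E] [NumberField E] (hE : isCompact_glFiniteIntegralLevel 1 E)
      (P₁ : CuspidalAutomorphicRepData 1 E hE), P₁.1.exists_hasInfinityType) :
    PrimeRankSelfTwistAvatar := by
  intro K _ _ n hcpt hn π hπ F _ _ _ hGal hcyc hFn hp hguard ℓ _ ι
  haveI := hGal
  have hF1 := isCompact_glFiniteIntegralLevel_holds 1 F
  have hguard' := acGuard_of_selfTwistGuard hp π hguard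
  obtain ⟨Pf, -, hAI⟩ :=
    hAC K F n 1 hp one_pos (by rw [one_mul]; exact hFn.symm) hcpt hF1 π hguard'
  have hAI₁ : IsAutomorphicInductionAlong (Pf 1).1 π.1 := hAI 1
  have hP₁L : (Pf 1).1.IsLAlgebraic :=
    isLAlgebraic_of_isAutomorphicInductionAlong hH hcyc one_pos (by rw [mul_one]; exact hFn) π
      (Pf 1) hAI₁ hπ (hInf F hF1 (Pf 1))
  obtain ⟨r, hr⟩ := exists_satakeFrobCompatible_rankOne hF1 (Pf 1) hP₁L ι
  exact inductionTransport_proof K F 1 n hF1 hcpt one_pos hn (Pf 1) π hP₁L hπ hAI₁ ℓ ι r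
    (FramedRep.isSemisimple_of_rank_one r) hr

/-- **SELF closed modulo PRINT and its composite-rank residual** (composition of `closes_self`
with `primeRankSelfTwistAvatar_of_print`). [folklore] -/
theorem closes_self_of_print
    (hAC : ArthurClozel1989_automorphicInduction_of_selfTwist)
    (hH : Henniart2012_infinityType_of_automorphicInduction)
    (hInf : ∀ (E : Type) [Field E] [NumberField E] (hE : isCompact_glFiniteIntegralLevel 1 E)
      (P₁ : CuspidalAutomorphicRepData 1 E hE), P₁.1.exists_hasInfinityType)
    (hC : CompositeRankSelfTwistedLayerDescent) : CyclicLayerPeeling.SelfTwistedLayerDescent :=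
  closes_self (primeRankSelfTwistAvatar_of_print hAC hH hInf) hC

/-- **RSELF closed modulo PRINT and its composite-rank residual.** [folklore] -/
theorem closes_rself_of_print
    (hAC : ArthurClozel1989_automorphicInduction_of_selfTwist)
    (hH : Henniart2012_infinityType_of_automorphicInduction)
    (hInf : ∀ (E : Type) [Field E] [NumberField E] (hE : isCompact_glFiniteIntegralLevel 1 E)
      (P₁ : CuspidalAutomorphicRepData 1 E hE), P₁.1.exists_hasInfinityType)
    (hC : CompositeRankSelfTwistedHullDescent) : GaloisHullLift.SelfTwistedHullDescent :=
  closes_rself (primeRankSelfTwistAvatar_of_print hAC hH hInf) hC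

/-- **Small ranks are residual-free**: for PRIME rank `n` the composite residual of SELF is void
(a prime has no proper prime divisor), so SELF at prime rank is PRSA alone. [folklore] -/
theorem compositeRankSelfTwistedLayerDescent_prime_rank_vacuous {K : Type} [Field K]
    [NumberField K] {n : ℕ} (hn : n.Prime) {M : Type} [Field M] [NumberField M] [Algebra K M]
    (F : IntermediateField K M) (hpF : (Module.finrank K ↥F).Prime)
    (hdvd : Module.finrank K ↥F ∣ n) (hlt : Module.finrank K ↥F < n) : False := by
  rcases (Nat.dvd_prime hn).1 hdvd with h1 | h2
  · exact hpF.one_lt.ne' h1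
  · omega

end Summit.Langlands.Langlands.Theorems.SelfTwistRankSplit
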